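import Summits.NavierStokesRegularity.NavierStokesRegularity.Theorems.SqueezeCycleExtremalBiaxialitySubcriticalPayerTomographyHessian
import Summits.NavierStokesRegularity.NavierStokesRegularity.Theorems.SqueezeCycleExtremalBiaxialitySubcriticalGaugeStrainBound
import Summits.NavierStokesRegularity.NavierStokesRegularity.Theorems.RellichScarSymmetricScarExistsApexRieszPressureLemmas
import Literature.Analysis.FluidPDE.TypeIAncientMild
import Literature.Analysis.FluidPDE.TypeIAncientMildClassical
import Literature.Analysis.FluidPDE.LerayGaugeStrainSpectrum
import Literature.Analysis.FluidPDE.DeviatoricHessian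
import Literature.Analysis.FluidPDE.ClassicalSolution
import Literature.Analysis.FluidPDE.PressurePoisson
import Literature.Analysis.FluidPDE.LerayProfileCalculus
import Literature.Analysis.FluidPDE.KNSSThm52Integrand
import Literature.Analysis.FluidPDE.PineauVicolOneSliceHigherGradient
import HarnessLib

/-!
# Route `SqueezeCycle`, crux `ExtremalBiaxialitySubcritical` — tomography of the non-local payer
# (line `oseen-shell-polar-tomography`, stub `stub_payerTomography`)

Helper file for item `stmt-NavierStokesRegularity-11609`
(`Summit.NavierStokesRegularity.NavierStokesRegularity.Theses.SqueezeCycle.ExtremalBiaxialitySubcritical`).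

Main result `stub_payerTomography`: for every Type-I constant `C` and `ε > 0` there is a gauge
radius `K = K(C, ε) ≥ 1` such that for every `u` with `IsTypeIAncientMild C u`, every classical
pressure `p` of `u` on a window `(t', 0)`, every `t ∈ (t', 0)`, `x` and unit `e`,
`|−(−t)²⟪ℌ^dev(p(t))(x) e, e⟫ − (−t)² ∫_{|z|<K√(−t)} k_e(z) (tr A(x)² − tr A(x−z)²) dz| ≤ ε`,
`k_e(z) = (3⟨z,e⟩² − |z|²)/(4π|z|⁵)`, `A = ∇u(t)`, `ℌ^dev` the deviatoric Hessian.

Proof. At every `z ≠ 0`, `k_e(z) = −D²Γ(z)(e,e)` (`pressureKernel_eq_neg_fderiv2`),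
  `tr A² = div((u·∇)u) = −Δp(t)` (`divergence_convect_self_eq`,
  `laplacian_pressure_eq_of_isClassicalNSSolutionOn`), `⟪ℌ^dev e,e⟫ = D²p(e,e) − Δp/3`; so the
  quantity is `(−t)²|D²p(e,e) + G/3 + I_R|`, `G = div((u·∇)u)`, `R = K√(−t)`, bounded by the
  tomography of file IV (`exists_hessian_tomography_bound`) by `(−t)² c₀ (M M₁/R + M²/R² + B/R)`.
  Class-uniform gauge bounds: `M = C/√(−t)` (Type-I rate), `M₁ = K₀(C)/(−t)`
  (`exists_gauge_norm_fderiv_le_of_typeI`, KNSS 2009 (4.10)), and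
  `B = B₀(C)(−t)^{−3/2}` for `∇p = Δu − ∂ₜu − (u·∇)u`, from the KNSS bounds (4.10) for `D²u` and
  (4.11) for `∂ₜu` transported by the Navier–Stokes zoom (`isTypeIAncientMild_zoom`). Hence the
  bound is `c₀ (C K₀/K + C²/K² + B₀/K) ≤ ε` for `K` large.

Sources: Koch–Nadirashvili–Seregin–Šverák, Acta Math. 203 (2009), Prop. 4.1, (4.10)–(4.11), §1
(1.2) [KochNadirashviliSereginSverak2009]; Gilbarg–Trudinger, Lemma 4.2 [GilbargTrudinger2001].
-/

noncomputable section

open MeasureTheory Set Filter Metric Topology InnerProductSpace Function Real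
open scoped RealInnerProductSpace Laplacian ContDiff ENNReal NNReal

namespace Summit.NavierStokesRegularity.NavierStokesRegularity.Theorems

open Literature.Analysis Literature.Analysis.FluidPDE

set_option linter.dupNamespace false

-- nested operator types `ℝ³ →L[ℝ] ℝ³ →L[ℝ] ℝ³ →L[ℝ] ℝ`
set_option maxSynthPendingDepth 4

/-! ## Class-uniform gauge bounds under the Navier–Stokes zoom -/

section GaugeBounds

variable {C : ℝ}

set_option maxHeartbeats 400000 in
/-- **Class-uniform gauge bound for the second derivatives**: there is `K₂ = K₂(C) ≥ 0` with
`(−t)^{3/2} ‖D²v(t)(x)‖ ≤ K₂` for every Type-I KNSS-mild ancient field `v` with constant `C`,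
`t < 0`, `x` (KNSS 2009, (4.10) with `k = 2` at `(−1, 0)` for the zoom `w(s,y) = c v(c²s, x + cy)`,
`c = √(−t)`, and `v(t) = c⁻¹ w(−1)(c⁻¹(· − x))`). [cite: KochNadirashviliSereginSverak2009, Prop. 4.1 (4.10) with §1 (1.2) (arXiv:0709.3599v1 pp. 2, 8)] -/
theorem exists_gauge_norm_iteratedFDeriv_two_le_of_typeI (C : ℝ) :
    ∃ K₂ : ℝ, 0 ≤ K₂ ∧ ∀ ⦃v : ℝ → EuclideanSpace ℝ (Fin 3) → EuclideanSpace ℝ (Fin 3)⦄,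
      IsTypeIAncientMild C v → ∀ t < 0, ∀ x,
        Real.sqrt (-t) ^ 3 * ‖iteratedFDeriv ℝ 2 (v t) x‖ ≤ K₂ := by
  obtain ⟨K, hK⟩ := exists_norm_iteratedFDeriv_le_of_typeI C 2 (a := -3) (b := -(1 / 2))
    (δ := 1) (by norm_num) (by norm_num) one_pos
  refine ⟨max K 0, le_max_right _ _, fun v hv t ht x => ?_⟩
  set c : ℝ := Real.sqrt (-t) with hcdef
  have hc : 0 < c := Real.sqrt_pos.2 (neg_pos.2 ht)
  have hc2 : c ^ 2 = -t := Real.sq_sqrt (neg_pos.2 ht).le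
  have hw : IsTypeIAncientMild C (c • stPull (c ^ 2) c 0 x v) := isTypeIAncientMild_zoom hv hc x
  have h := hK hw.continuousOn_uncurry (fun s hs => hw.isWeaklyDivFree hs)
    (fun s r hsr hr y => hw.mild_eq_heatExtension hsr hr y) hw.hasTypeITimeDecay (-1)
    ⟨by norm_num, by norm_num⟩ 0
  have hsm : ContDiff ℝ (⊤ : ℕ∞) ((c • stPull (c ^ 2) c 0 x v) (-1)) :=
    hw.contDiff_slice (by norm_num)
  have hvt : v t = fun y => c⁻¹ • (c • stPull (c ^ 2) c 0 x v) (-1) (c⁻¹ • (y - x)) := by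
    funext y
    rw [zoom_apply, hc2, show -t * (-1) = t by ring, smul_smul, inv_mul_cancel₀ hc.ne', one_smul,
      smul_smul, mul_inv_cancel₀ hc.ne', one_smul, add_sub_cancel]
  calc c ^ 3 * ‖iteratedFDeriv ℝ 2 (v t) x‖
      = c ^ 3 * ‖iteratedFDeriv ℝ 2
          (fun y => c⁻¹ • (c • stPull (c ^ 2) c 0 x v) (-1) (c⁻¹ • (y - x))) x‖ := by rw [← hvt]
    _ ≤ c ^ 3 * (|c⁻¹| * |c⁻¹| ^ 2 *
          ‖iteratedFDeriv ℝ 2 ((c • stPull (c ^ 2) c 0 x v) (-1)) (c⁻¹ • (x - x))‖) :=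
        mul_le_mul_of_nonneg_left (norm_iteratedFDeriv_smul_comp_smul_sub_le hsm _ _ _ _ 2)
          (by positivity)
    _ = ‖iteratedFDeriv ℝ 2 ((c • stPull (c ^ 2) c 0 x v) (-1)) 0‖ := by
        rw [sub_self, smul_zero, abs_of_pos (inv_pos.2 hc)]
        field_simp
    _ ≤ K := h
    _ ≤ max K 0 := le_max_left _ _

set_option maxHeartbeats 400000 in
/-- **Class-uniform gauge bound for the time derivative of the slices**: there is
`L₀ = L₀(C) ≥ 0` with `(−t)^{3/2} ‖d/ds v(s, x)|_{s=t}‖ ≤ L₀` for every Type-I KNSS-mild ancient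
field `v` with constant `C`, `t < 0`, `x` (KNSS 2009, (4.11) with `k = 0`: the time-Lipschitz
bound at `s = −1` for the zoom `w(s, 0) = c v(c²s, x)`, and the chain rule
`∂ₛw(−1, 0) = c³ ∂ₜv(t, x)`; the `deriv`-form used with `timeDerivWithin_eq_deriv`).
[cite: KochNadirashviliSereginSverak2009, §4 (4.11) with §1 (1.2) (arXiv:0709.3599v1 pp. 2, 8)] -/
theorem exists_gauge_norm_deriv_slice_le_of_typeI (C : ℝ) :
    ∃ L₀ : ℝ, 0 ≤ L₀ ∧ ∀ ⦃v : ℝ → EuclideanSpace ℝ (Fin 3) → EuclideanSpace ℝ (Fin 3)⦄,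
      IsTypeIAncientMild C v → ∀ t < 0, ∀ x,
        Real.sqrt (-t) ^ 3 * ‖deriv (fun s => v s x) t‖ ≤ L₀ := by
  obtain ⟨L, hL0, hL⟩ := exists_lipschitz_time_of_typeI C 0 (a := -3) (b := -(1 / 2)) (δ := 1)
    (by norm_num) (by norm_num) one_pos
  refine ⟨L, hL0, fun v hv t ht x => ?_⟩
  set c : ℝ := Real.sqrt (-t) with hcdef
  have hc : 0 < c := Real.sqrt_pos.2 (neg_pos.2 ht)
  have hc2 : c ^ 2 = -t := Real.sq_sqrt (neg_pos.2 ht).le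
  have hw : IsTypeIAncientMild C (c • stPull (c ^ 2) c 0 x v) := isTypeIAncientMild_zoom hv hc x
  -- the time-Lipschitz bound of the zoom at `(−1, 0)`
  have hlip : ∀ᶠ s in 𝓝 (-1 : ℝ), ‖(c • stPull (c ^ 2) c 0 x v) s 0 -
      (c • stPull (c ^ 2) c 0 x v) (-1) 0‖ ≤ L * ‖s - (-1)‖ := by
    filter_upwards [Ico_mem_nhds (by norm_num : (-3 : ℝ) + 1 < -1)
      (by norm_num : (-1 : ℝ) < -(1 / 2))] with s hs
    have h := hL hw.continuousOn_uncurry (fun s hs => hw.isWeaklyDivFree hs)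
      (fun s r hsr hr y => hw.mild_eq_heatExtension hsr hr y) hw.hasTypeITimeDecay (-1)
      ⟨by norm_num, by norm_num⟩ s hs 0
    have hs0 : s < 0 := by linarith [hs.2]
    rw [← iteratedFDeriv_sub_apply (contDiff_infty.1 (hw.contDiff_slice hs0) 0).contDiffAt
      (contDiff_infty.1 (hw.contDiff_slice (by norm_num : (-1 : ℝ) < 0)) 0).contDiffAt,
      norm_iteratedFDeriv_zero] at h
    rw [Real.norm_eq_abs]
    exact h
  have hderiv : ‖deriv (fun s => (c • stPull (c ^ 2) c 0 x v) s 0) (-1)‖ ≤ L :=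
    norm_deriv_le_of_lip' hL0 hlip
  -- the chain rule
  have hψd : DifferentiableAt ℝ (fun τ => v τ x) t := by
    have h1 : ContDiffAt ℝ (⊤ : ℕ∞) (uncurry v) (t, x) :=
      hv.contDiffOn.contDiffAt ((isOpen_Iio.prod isOpen_univ).mem_nhds ⟨ht, mem_univ _⟩)
    have h2 : DifferentiableAt ℝ (uncurry v) (t, x) := h1.differentiableAt (by simp)
    have h3 : DifferentiableAt ℝ (fun s : ℝ => (s, x)) t :=
      differentiableAt_id.prodMk (differentiableAt_const x)
    exact h2.comp t h3
  have hchain : HasDerivAt (fun s => (c • stPull (c ^ 2) c 0 x v) s 0)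
      (c • ((c ^ 2) • deriv (fun τ => v τ x) t)) (-1) := by
    have h1 : HasDerivAt (fun s : ℝ => c ^ 2 * s) (c ^ 2) (-1) := by
      simpa using (hasDerivAt_id (-1 : ℝ)).const_mul (c ^ 2)
    have h2 : HasDerivAt (fun τ => v τ x) (deriv (fun τ => v τ x) t) (c ^ 2 * (-1)) := by
      rw [hc2, show -t * (-1) = t by ring]
      exact hψd.hasDerivAt
    have h3 := (h2.scomp (-1) h1).const_smul c
    refine h3.congr_of_eventuallyEq (Eventually.of_forall fun s => ?_)
    simp only [Pi.smul_apply, Function.comp_apply, zoom_apply, smul_zero, add_zero]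
  rw [hchain.deriv, norm_smul, norm_smul, Real.norm_of_nonneg hc.le,
    Real.norm_of_nonneg (sq_nonneg c)] at hderiv
  calc c ^ 3 * ‖deriv (fun s => v s x) t‖ = c * (c ^ 2 * ‖deriv (fun τ => v τ x) t‖) := by ring
    _ ≤ L := hderiv

set_option maxHeartbeats 400000 in
/-- **Class-uniform gauge bound for the pressure gradient**: there is `B₀ = B₀(C) ≥ 0` such that
for every Type-I KNSS-mild ancient field `u` with constant `C`, every classical pressure `p` of
`u` on a window `(t', 0)` (`ν = 1`, `f = 0`), every `t ∈ (t', 0)` and `x`,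
`(−t)^{3/2} ‖∇p(t)(x)‖ ≤ B₀`: `∇p = Δu − ∂ₜu − (u·∇)u` (momentum equation at the interior time `t`)
and the class-uniform gauge bounds for `D²u` (`‖Δu‖ ≤ 3‖D²u‖`), `∂ₜu`, `∇u`, `u`. [cite: KochNadirashviliSereginSverak2009, Prop. 4.1 (4.10)–(4.11) (arXiv:0709.3599v1 p. 8)] -/
theorem exists_gauge_norm_fderiv_pressure_le_of_typeI (C : ℝ) :
    ∃ B₀ : ℝ, 0 ≤ B₀ ∧ ∀ ⦃u : ℝ → EuclideanSpace ℝ (Fin 3) → EuclideanSpace ℝ (Fin 3)⦄,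
      IsTypeIAncientMild C u → ∀ (t' : ℝ) (p : ℝ → EuclideanSpace ℝ (Fin 3) → ℝ),
      IsClassicalNSSolutionOn (Set.Ioo t' 0) 1 0 u p → ∀ t, t' < t → t < 0 → ∀ x,
        Real.sqrt (-t) ^ 3 * ‖fderiv ℝ (p t) x‖ ≤ B₀ := by
  obtain ⟨K₀, hK₀⟩ := exists_gauge_norm_fderiv_le_of_typeI C
  obtain ⟨K₂, hK₂0, hK₂⟩ := exists_gauge_norm_iteratedFDeriv_two_le_of_typeI C
  obtain ⟨L₀, hL₀0, hL₀⟩ := exists_gauge_norm_deriv_slice_le_of_typeI C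
  refine ⟨3 * K₂ + L₀ + |K₀| * |C|, by positivity, ?_⟩
  intro u hu t' p hcl t ht't ht x
  set c : ℝ := Real.sqrt (-t) with hcdef
  have hc : 0 < c := Real.sqrt_pos.2 (neg_pos.2 ht)
  have hc2 : c ^ 2 = -t := Real.sq_sqrt (neg_pos.2 ht).le
  have htS : t ∈ Ioo t' 0 := ⟨ht't, ht⟩
  -- the momentum equation solved for `∇p`
  have hmom := hcl.momentum t htS x
  rw [timeDerivWithin_eq_deriv isOpen_Ioo htS, one_smul] at hmom
  have hgrad : gradient (p t) x =
      Δ (u t) x - deriv (fun s => u s x) t - convect (u t) (u t) x := by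
    have h3 : Δ (u t) x - gradient (p t) x + (0 : ℝ → EuclideanSpace ℝ (Fin 3) →
        EuclideanSpace ℝ (Fin 3)) t x = deriv (fun s => u s x) t + convect (u t) (u t) x :=
      hmom.symm
    calc gradient (p t) x = Δ (u t) x - (Δ (u t) x - gradient (p t) x +
          (0 : ℝ → EuclideanSpace ℝ (Fin 3) → EuclideanSpace ℝ (Fin 3)) t x) := by
            simp only [Pi.zero_apply, add_zero, sub_sub_cancel]
      _ = _ := by rw [h3]; abel
  -- the four gauge bounds
  have h1 : ‖Δ (u t) x‖ ≤ 3 * (K₂ / c ^ 3) := by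
    refine (norm_laplacian_le_three_mul _ _).trans (mul_le_mul_of_nonneg_left ?_ (by norm_num))
    rw [le_div_iff₀ (by positivity), mul_comm]
    exact hK₂ hu t ht x
  have h2 : ‖deriv (fun s => u s x) t‖ ≤ L₀ / c ^ 3 := by
    rw [le_div_iff₀ (by positivity), mul_comm]
    exact hL₀ hu t ht x
  have h3 : ‖convect (u t) (u t) x‖ ≤ (|K₀| / c ^ 2) * (|C| / c) := by
    rw [convect_apply]
    refine (ContinuousLinearMap.le_opNorm _ _).trans (mul_le_mul ?_ ?_ (norm_nonneg _) (by positivity))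
    · rw [le_div_iff₀ (by positivity), mul_comm, hc2]
      exact (hK₀ hu t ht x).trans (le_abs_self _)
    · exact (hu.norm_le ht x).trans (div_le_div_of_nonneg_right (le_abs_self C) hc.le)
  have hgn : ‖fderiv ℝ (p t) x‖ = ‖gradient (p t) x‖ := by
    rw [gradient, LinearIsometryEquiv.norm_map]
  rw [hgn, hgrad]
  have hc3 : 0 < c ^ 3 := by positivity
  have key : c ^ 3 * ‖Δ (u t) x - deriv (fun s => u s x) t - convect (u t) (u t) x‖ ≤
      c ^ 3 * (3 * (K₂ / c ^ 3) + L₀ / c ^ 3 + (|K₀| / c ^ 2) * (|C| / c)) := by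
    refine mul_le_mul_of_nonneg_left ?_ hc3.le
    exact ((norm_sub_le _ _).trans (add_le_add ((norm_sub_le _ _).trans (add_le_add h1 h2)) h3))
  have e : c ^ 3 * (3 * (K₂ / c ^ 3) + L₀ / c ^ 3 + (|K₀| / c ^ 2) * (|C| / c)) =
      3 * K₂ + L₀ + |K₀| * |C| := by
    field_simp
  exact key.trans_eq e

set_option maxHeartbeats 400000 in
/-- **Bounds for the source `G = div((u·∇)u)(t, ·)` of one field at one time** (qualitative):
`G`, `∇G` are bounded (`G = ∂ᵢ∂ⱼ(uᵢuⱼ)` for `div u = 0`; `norm_iteratedFDeriv_pressureSource_le`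
against the KNSS bounds for `Dʲu(t)`, `j ≤ 3`). [folklore] -/
theorem exists_source_bounds {u : ℝ → EuclideanSpace ℝ (Fin 3) → EuclideanSpace ℝ (Fin 3)}
    (hu : IsTypeIAncientMild C u) {t : ℝ} (ht : t < 0) :
    ∃ S L : ℝ, (∀ y, ‖VectorCalculus.divergence (convect (u t) (u t)) y‖ ≤ S) ∧
      ∀ y, ‖fderiv ℝ (VectorCalculus.divergence (convect (u t) (u t))) y‖ ≤ L := by
  have hwin : ∀ j : ℕ, ∃ Kj : ℝ, ∀ y, ‖iteratedFDeriv ℝ j (u t) y‖ ≤ Kj := fun j => by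
    obtain ⟨K, hK⟩ := exists_norm_iteratedFDeriv_le_of_typeI C j (a := 2 * t) (b := t / 2)
      (δ := -t / 2) (by linarith) (by linarith) (by linarith)
    exact ⟨K, fun y => hK hu.continuousOn_uncurry (fun s hs => hu.isWeaklyDivFree hs)
      (fun s r hsr hr y => hu.mild_eq_heatExtension hsr hr y) hu.hasTypeITimeDecay t
      ⟨by linarith, by linarith⟩ y⟩
  obtain ⟨B0, hB0⟩ := hwin 0
  obtain ⟨B1, hB1⟩ := hwin 1
  obtain ⟨B2, hB2⟩ := hwin 2
  obtain ⟨B3, hB3⟩ := hwin 3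
  set Bm : ℝ := max (max (max B0 B1) (max B2 B3)) 0 with hBm
  have hBm0 : 0 ≤ Bm := le_max_right _ _
  have hBj : ∀ j ≤ 3, ∀ y, ‖iteratedFDeriv ℝ j (u t) y‖ ≤ Bm := by
    intro j hj y
    interval_cases j
    · exact (hB0 y).trans ((le_max_left _ _).trans ((le_max_left _ _).trans (le_max_left _ _)))
    · exact (hB1 y).trans ((le_max_right _ _).trans ((le_max_left _ _).trans (le_max_left _ _)))
    · exact (hB2 y).trans ((le_max_left _ _).trans ((le_max_right _ _).trans (le_max_left _ _)))
    · exact (hB3 y).trans ((le_max_right _ _).trans ((le_max_right _ _).trans (le_max_left _ _)))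
  have hsm : ContDiff ℝ ∞ (u t) := hu.contDiff_slice ht
  have hG : pressureSource (u t) = VectorCalculus.divergence (convect (u t) (u t)) :=
    pressureSource_eq_of_isDivFree (hu.isDivFree ht)
  refine ⟨‖(traceCLM : (EuclideanSpace ℝ (Fin 3) →L[ℝ] EuclideanSpace ℝ (Fin 3)) →L[ℝ] ℝ)‖ *
      ((1 + ‖(traceCLM : (EuclideanSpace ℝ (Fin 3) →L[ℝ] EuclideanSpace ℝ (Fin 3)) →L[ℝ] ℝ)‖) *
        (2 ^ (0 + 1) * Bm ^ 2)),
    ‖(traceCLM : (EuclideanSpace ℝ (Fin 3) →L[ℝ] EuclideanSpace ℝ (Fin 3)) →L[ℝ] ℝ)‖ *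
      ((1 + ‖(traceCLM : (EuclideanSpace ℝ (Fin 3) →L[ℝ] EuclideanSpace ℝ (Fin 3)) →L[ℝ] ℝ)‖) *
        (2 ^ (1 + 1) * Bm ^ 2)), fun y => ?_, fun y => ?_⟩
  · have h := SymmetricScarExists.LogtimeBernoulli.norm_iteratedFDeriv_pressureSource_le hsm 0
      hBm0 y (fun j hj => hBj j (by omega) y)
    rw [norm_iteratedFDeriv_zero, hG] at h
    exact h
  · have h := SymmetricScarExists.LogtimeBernoulli.norm_iteratedFDeriv_pressureSource_le hsm 1
      hBm0 y (fun j hj => hBj j (by omega) y)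
    rw [← norm_iteratedFDeriv_fderiv, norm_iteratedFDeriv_zero, hG] at h
    exact h

end GaugeBounds

/-! ## Identification of the two sides and the stub -/

section Stub

/-- `⟪ℌ^dev(q)(x) e, e⟫ = D²q(x)(e,e) − Δq(x)/3` on `ℝ³` for a unit vector `e`. [folklore] -/
theorem inner_deviatoricHessian_self_fin3 (q : EuclideanSpace ℝ (Fin 3) → ℝ)
    (x : EuclideanSpace ℝ (Fin 3)) {e : EuclideanSpace ℝ (Fin 3)} (he : ‖e‖ = 1) :
    inner ℝ (deviatoricHessian q x e) e = fderiv ℝ (fderiv ℝ q) x e e - (Δ q) x / 3 := by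
  rw [real_inner_comm, inner_deviatoricHessian_apply, iteratedFDeriv_two_apply,
    finrank_euclideanSpace_fin, real_inner_self_eq_norm_sq, he]
  simp

set_option maxHeartbeats 400000 in
/-- **The polar-quadrupole kernel is `−D²Γ(e,e)`**: for `‖e‖ = 1` and `z ≠ 0`,
`(3⟨z,e⟩² − |z|²)/(4π|z|⁵) = −D²Γ(z)(e,e)`, `Γ = −1/(4π|z|)` (Gilbarg–Trudinger (2.13)). [folklore] -/
theorem quadrupoleKernel_eq_neg_fderiv2 {e : EuclideanSpace ℝ (Fin 3)} (he : ‖e‖ = 1)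
    {z : EuclideanSpace ℝ (Fin 3)} (hz : z ≠ 0) :
    (3 * ⟪z, e⟫ ^ 2 - ‖z‖ ^ 2) / (4 * Real.pi * ‖z‖ ^ 5) =
      -fderiv ℝ (fderiv ℝ newtonKernel) z e e := by
  rw [← pressureKernel_eq_neg_fderiv2 hz, pressureKernel_eq_fin3, he, one_pow, one_mul]

set_option maxHeartbeats 400000 in
/-- **stub_payerTomography** (line `oseen-shell-polar-tomography` of crux
`ExtremalBiaxialitySubcritical`) — tomography of the non-local payer: for every `C` and `ε > 0`
there is `K = K(C, ε) ≥ 1` such that for every `u ∈ IsTypeIAncientMild C`, every classical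
pressure `p` of `u` on `(t', 0)`, every `t ∈ (t', 0)`, `x` and unit `e`, the gauge deviatoric
pressure Hessian `−(−t)²⟪ℌ^dev(p t)(x)e, e⟫` is within `ε` of the truncated polar-quadrupole
transform `(−t)² ∫_{|z|<K√(−t)} (3⟨z,e⟩² − |z|²)/(4π|z|⁵) (tr A(x)² − tr A(x−z)²) dz`,
`A = ∇u(t)`: `k_e = −D²Γ(e,e)`, `tr A² = div((u·∇)u) = −Δp`, `⟪ℌ^dev e,e⟫ = D²p(e,e) − Δp/3`
reduce the claim to `exists_hessian_tomography_bound`, fed with the gauge bounds `M = C/√(−t)`,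
`M₁ = K₀/(−t)`, `B = B₀(−t)^{−3/2}` at `R = K√(−t)`: error `c₀(CK₀/K + C²/K² + B₀/K) ≤ ε`.
[cite: KochNadirashviliSereginSverak2009, Prop. 4.1 (4.10)–(4.11) with §1 (1.2) (arXiv:0709.3599v1 pp. 2, 8)] -/
theorem stub_payerTomography :
    ∀ (C ε : ℝ), 0 < ε → ∃ K : ℝ, 1 ≤ K ∧ ∀ (u : ℝ → EuclideanSpace ℝ (Fin 3) → EuclideanSpace ℝ (Fin 3)), IsTypeIAncientMild C u → ∀ (t' : ℝ) (p : ℝ → EuclideanSpace ℝ (Fin 3) → ℝ), IsClassicalNSSolutionOn (Set.Ioo t' 0) 1 0 u p → ∀ (t : ℝ), t' < t → t < 0 → ∀ (x e : EuclideanSpace ℝ (Fin 3)), ‖e‖ = 1 → |-((-t) ^ 2 * inner ℝ (deviatoricHessian (p t) x e) e) - (-t) ^ 2 * (∫ z in Metric.ball (0 : EuclideanSpace ℝ (Fin 3)) (K * Real.sqrt (-t)), (3 * inner ℝ z e ^ 2 - ‖z‖ ^ 2) / (4 * Real.pi * ‖z‖ ^ 5) * (LinearMap.trace ℝ (EuclideanSpace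 ℝ (Fin 3)) ((fderiv ℝ (u t) x).comp (fderiv ℝ (u t) x)).toLinearMap - LinearMap.trace ℝ (EuclideanSpace ℝ (Fin 3)) ((fderiv ℝ (u t) (x - z)).comp (fderiv ℝ (u t) (x - z))).toLinearMap))| ≤ ε := by
  intro C ε hε
  obtain ⟨c₀, hc₀0, hc₀⟩ := exists_hessian_tomography_bound
  obtain ⟨K₀, hK₀⟩ := exists_gauge_norm_fderiv_le_of_typeI C
  obtain ⟨B₀, hB₀0, hB₀⟩ := exists_gauge_norm_fderiv_pressure_le_of_typeI C
  set A : ℝ := c₀ * (|C| * |K₀| + C ^ 2 + B₀) with hA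
  have hA0 : 0 ≤ A := by positivity
  refine ⟨max 1 ((A + 1) / ε), le_max_left _ _, ?_⟩
  intro u hu t' p hcl t ht't ht x e he
  set K : ℝ := max 1 ((A + 1) / ε) with hKdef
  have hK1 : (1 : ℝ) ≤ K := le_max_left _ _
  have hKpos : (0 : ℝ) < K := one_pos.trans_le hK1
  have hKε : (A + 1) / ε ≤ K := le_max_right _ _
  have hC0 : 0 ≤ C := hu.nonneg
  set c : ℝ := Real.sqrt (-t) with hcdef
  have hc : 0 < c := Real.sqrt_pos.2 (neg_pos.2 ht)
  have hc2 : c ^ 2 = -t := Real.sq_sqrt (neg_pos.2 ht).le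
  have hR : 0 < K * c := mul_pos hKpos hc
  have htS : t ∈ Ioo t' 0 := ⟨ht't, ht⟩
  -- the data at time `t`
  have hut : ContDiff ℝ 4 (u t) := contDiff_infty.1 (hu.contDiff_slice ht) 4
  have hut2 : ContDiff ℝ 2 (u t) := contDiff_infty.1 (hu.contDiff_slice ht) 2
  have hdiv : VectorCalculus.IsDivFree (u t) := hu.isDivFree ht
  have hM : ∀ y, ‖u t y‖ ≤ C / c := fun y => hu.norm_le ht y
  have hM₁ : ∀ y, ‖fderiv ℝ (u t) y‖ ≤ |K₀| / c ^ 2 := fun y => by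
    rw [le_div_iff₀ (by positivity), mul_comm, hc2]
    exact (hK₀ hu t ht y).trans (le_abs_self _)
  have hpt : ContDiff ℝ 4 (p t) := contDiff_infty.1 (hcl.contDiff_pressure htS) 4
  have hΔp : ∀ y, (Δ (p t)) y = -VectorCalculus.divergence (convect (u t) (u t)) y := by
    intro y
    have h := laplacian_pressure_eq_of_isClassicalNSSolutionOn hcl
      (by rw [isOpen_Ioo.interior_eq]; exact htS) y
    rw [h]
    simp [VectorCalculus.divergence]
  have hB : ∀ y, ‖fderiv ℝ (p t) y‖ ≤ B₀ / c ^ 3 := fun y => by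
    rw [le_div_iff₀ (by positivity), mul_comm]
    exact hB₀ hu t' p hcl t ht't ht y
  obtain ⟨S, L, hS, hL⟩ := exists_source_bounds hu ht
  -- the tomography bound for `q = p(t)`
  have key := hc₀ (u t) (p t) (C / c) (|K₀| / c ^ 2) (B₀ / c ^ 3) S L (K * c)
    x e hut hdiv hM hM₁ hpt hΔp hB hS hL hR he
  -- identification of the two sides
  set G : EuclideanSpace ℝ (Fin 3) → ℝ := VectorCalculus.divergence (convect (u t) (u t)) with hGdef
  have hT : ∀ y, LinearMap.trace ℝ (EuclideanSpace ℝ (Fin 3))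
      ((fderiv ℝ (u t) y).comp (fderiv ℝ (u t) y)).toLinearMap = G y := by
    intro y
    rw [hGdef, divergence_convect_self_eq hut2 hdiv y, traceCLM_apply]
  have hI : ∫ z in Metric.ball (0 : EuclideanSpace ℝ (Fin 3)) (K * c),
      (3 * inner ℝ z e ^ 2 - ‖z‖ ^ 2) / (4 * Real.pi * ‖z‖ ^ 5) *
        (LinearMap.trace ℝ (EuclideanSpace ℝ (Fin 3))
          ((fderiv ℝ (u t) x).comp (fderiv ℝ (u t) x)).toLinearMap -
          LinearMap.trace ℝ (EuclideanSpace ℝ (Fin 3))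
            ((fderiv ℝ (u t) (x - z)).comp (fderiv ℝ (u t) (x - z))).toLinearMap) =
      ∫ z in Metric.ball (0 : EuclideanSpace ℝ (Fin 3)) (K * c),
        fderiv ℝ (fderiv ℝ newtonKernel) z e e * (G (x - z) - G x) := by
    have hae : ∀ᵐ z ∂(volume : Measure (EuclideanSpace ℝ (Fin 3))),
        z ≠ (0 : EuclideanSpace ℝ (Fin 3)) := by
      rw [ae_iff]; simp
    refine setIntegral_congr_ae measurableSet_ball ?_
    filter_upwards [hae] with z hz _
    rw [quadrupoleKernel_eq_neg_fderiv2 he hz, hT, hT]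
    ring
  rw [inner_deviatoricHessian_self_fin3 (p t) x he, hI, hΔp x]
  have hrw : -((-t) ^ 2 * (fderiv ℝ (fderiv ℝ (p t)) x e e - -G x / 3)) -
      (-t) ^ 2 * ∫ z in Metric.ball (0 : EuclideanSpace ℝ (Fin 3)) (K * c),
        fderiv ℝ (fderiv ℝ newtonKernel) z e e * (G (x - z) - G x) =
      -((-t) ^ 2 * (fderiv ℝ (fderiv ℝ (p t)) x e e + G x / 3 +
        ∫ z in Metric.ball (0 : EuclideanSpace ℝ (Fin 3)) (K * c),
          fderiv ℝ (fderiv ℝ newtonKernel) z e e * (G (x - z) - G x))) := by ring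
  rw [hrw, abs_neg, abs_mul, abs_of_nonneg (sq_nonneg _)]
  -- bookkeeping
  have hKne : K ≠ 0 := hKpos.ne'
  calc (-t) ^ 2 * |fderiv ℝ (fderiv ℝ (p t)) x e e + G x / 3 +
        ∫ z in Metric.ball (0 : EuclideanSpace ℝ (Fin 3)) (K * c),
          fderiv ℝ (fderiv ℝ newtonKernel) z e e * (G (x - z) - G x)|
      ≤ (-t) ^ 2 * (c₀ * (C / c * (|K₀| / c ^ 2) / (K * c) +
          (C / c) ^ 2 / (K * c) ^ 2 +
            B₀ / c ^ 3 / (K * c))) :=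
        mul_le_mul_of_nonneg_left key (sq_nonneg _)
    _ = c₀ * (C * |K₀| / K + C ^ 2 / K ^ 2 +
          B₀ / K) := by
        rw [← hc2]
        field_simp
    _ ≤ c₀ * ((|C| * |K₀| + C ^ 2 + B₀) / K) := by
        refine mul_le_mul_of_nonneg_left ?_ hc₀0
        rw [add_div, add_div]
        refine add_le_add (add_le_add ?_ ?_) le_rfl
        · exact div_le_div_of_nonneg_right
            (mul_le_mul_of_nonneg_right (le_abs_self C) (abs_nonneg _)) hKpos.le
        · rw [div_le_div_iff₀ (by positivity) hKpos]
          nlinarith [sq_nonneg C, hK1, mul_nonneg (sq_nonneg C) hKpos.le]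
    _ = A / K := by rw [hA]; ring
    _ ≤ ε := by
        rw [div_le_iff₀ hKpos]
        rw [div_le_iff₀ hε] at hKε
        nlinarith [hKε, hε]

end Stub

end Summit.NavierStokesRegularity.NavierStokesRegularity.Theorems

end
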